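import Summits.QuantumFields.YangMills.Theorems.InfiniteVolumeLatticeDistributions
import Summits.QuantumFields.YangMills.Theorems.LangevinControlUVOSLegsFromFemtoAndGapStubAssemblyPlaneStrings
import Mathlib.Analysis.Normed.Group.Tannery
import HarnessLib

/-!
# Infinite volume by compactness, step 5: at fixed spacing the TORUS plane-string distributions of the spine
# converge to the infinite-volume series of the limit state (Tannery), and a diagonal selection lemma

HONEST FRAMING (cell `ym-fleet`, seat `ym-infvol-p2`, director-ym R136 (i) «INFINITE-VOLUME ∕ CONTINUUM-FROM-UV
ROUTE», pre-birth helper; bears on LADDER-YM R1∕R2a).  Pure soft analysis, kernel-checked; NOTHING here is a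
statement about Bałaban's renormalisation group, the OS axioms, uniqueness of the infinite-volume state, a mass gap,
or Clay.  No Yang–Mills input is consumed at all: this file needs NO moment bound — only boundedness of the plane
fields and Schwartz decay.

WHY (the junction between the «`L → ∞` first» objects and the spine's torus species schemes).  The spine's legs —
`ROT`'s `LatticeRotWard`, the reflection-positivity and hypercubic toolkits — speak about the TORUS plane-string
distributions `latticeDistStr r.ρ β L a …` along species schemes `(β_k, L_k, a_k)`.  The infinite-volume route reads
the series `F ↦ Σ'ₓ W_μ(q,x)·F(a·x + o)` of a thermodynamic limit state `μ ∈ oddTorusLimitPoints r β`.  This file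
shows that, at FIXED `(β, a)` and along `μ`'s own defining odd-torus sequence `S_k`, the torus distributions converge
to the infinite-volume series, for EVERY Schwartz test function (no off-diagonality, no collar bound): the torus
weights converge pointwise (step 1) and the torus box sums are dominated by a summable Schwartz majorant (step 3),
so Tannery's theorem applies.  With the diagonal selection lemma of §3 a consumer chooses torus sides `L_k = S_{m_k}`
above any growth demand and `1/(k+1)`-close to the infinite-volume functionals on the first `k` members of a
countable test family — so the «`L → ∞` first» limits ARE limits along a torus species scheme (density upgrade: the
successor file).

WHAT IS PROVED ([folklore] throughout).
* §1 `mem_piFinset_box_mono`, `eventually_mem_piFinset_box` (boxes exhaust `(ℤ⁴)ⁿ` along `S_k ↑ ∞`),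
  **`tendsto_torusMomentStr_infVolWeight`** (along `IsInfiniteVolumeLimitAlong r.ρ β (2S·) μ`: the spine's torus
  weight `torusMomentStr r.ρ β (S k) (planes q) (torus means) x → ∫ ∏ᵢ (plane qᵢ xᵢ − ∫ plane qᵢ xᵢ dμ) dμ`; step 1's
  `tendsto_wilsonExpectation_centred_prod` read through `torusE_prod_plane_eq_torusMomentStr`).
* §2 **`tendsto_sum_torusMomentStr_mul_tsum`** (Tannery): for `0 < a ≤ 1`, shifts `‖(y x)_l − a·x_l‖ ≤ s·a` with
  `s·a ≤ 1/4` and ANY `F ∈ 𝓢`: `Σ_{x ∈ (box (S k))ⁿ} torusMomentStr_k(x)·F(y x) → Σ'ₓ W_μ(q,x)·F(y x)`;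
  **`tendsto_latticeDistStr_tsum`** (base points: the spine's `latticeDistStr r.ρ β (S k) a (planes q) (means) F`
  converges to the infinite-volume series at `y x = a·x`); `…_of_mem_oddTorusLimitPoints` packaging.
* §3 **`exists_growth_diagonal`** — generic diagonal selection: countably many targets `c k i` approached by
  `u k i m → c k i` (`m → ∞`) for each `k` ⟹ `∃ L ≥ g` pointwise with `‖u k i (L k) − c k i‖ ≤ 1/(k+1)` for all
  large `k`, for every `i`; and `tendsto_sub_diagonal` (hence `u k i (L k) − c k i → 0`).

References: Glimm–Jaffe (1987) §6.1; Osterwalder–Schrader CMP 42 (1975) §2; Chatterjee arXiv:1803.01950 §2.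
-/

set_option autoImplicit false

noncomputable section

open scoped BigOperators SchwartzMap
open MeasureTheory Filter Topology
open Literature.MathematicalPhysics.QuantumFieldTheory hiding ZdEdge
open Literature.MathematicalPhysics.QuantumLattice
open Literature.MathematicalPhysics.AQFT
open Literature.Probability.LatticeModels (box Site mem_box)
open Summit.QuantumFields.YangMills.Cruxes.OSLegsFromFemtoAndGap.DlrCollarTransfer
  (plane torusE exists_abs_plane_le continuous_plane isCylinder_plane)
open Summit.QuantumFields.YangMills.Theorems.OSLegsFromFemtoAndGap
  (torusMomentStr latticeDistStr latticeDistStr_apply torusE_prod_plane_eq_torusMomentStr abs_torusMomentStr_plane_le)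

namespace Summit.QuantumFields.YangMills.Theorems.InfiniteVolume

/-! ## §1 Boxes exhaust `(ℤ⁴)ⁿ`; the torus weights converge to the weights of the limit state -/

section Pointwise

/-- Boxes are monotone: `(box L)ⁿ ⊆ (box L')ⁿ` for `L ≤ L'`. [folklore] -/
theorem mem_piFinset_box_mono {n L L' : ℕ} (hLL' : L ≤ L') {x : Fin n → Site 4}
    (hx : x ∈ Fintype.piFinset (fun _ : Fin n => box 4 L)) : x ∈ Fintype.piFinset (fun _ : Fin n => box 4 L') := by
  rw [Fintype.mem_piFinset] at hx ⊢
  intro l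
  have h := (mem_box.1 (hx l))
  rw [mem_box]
  intro m
  have := h m
  constructor <;> omega

/-- Along a strictly increasing `S`, every multi-site eventually lies in `(box (S k))ⁿ`. [folklore] -/
theorem eventually_mem_piFinset_box {n : ℕ} {S : ℕ → ℕ} (hS : StrictMono S) (x : Fin n → Site 4) :
    ∀ᶠ k in atTop, x ∈ Fintype.piFinset (fun _ : Fin n => box 4 (S k)) := by
  obtain ⟨L, -, hL⟩ := subset_piFinset_box ({x} : Finset (Fin n → Site 4)) 0
  filter_upwards [eventually_le_of_strictMono hS L] with k hk
  exact mem_piFinset_box_mono hk (hL (Finset.mem_singleton_self x))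

end Pointwise

section PointwiseG

variable {G : Type} [Group G] [TopologicalSpace G] [IsTopologicalGroup G] [CompactSpace G]
  [MeasurableSpace G] [BorelSpace G]

/-- **The spine's torus plane-string weights converge to the weights of the limit state** along
`IsInfiniteVolumeLimitAlong r.ρ β (2S·) μ`: for every string `q` and sites `x`,
`torusMomentStr r.ρ β (S k) (planes q) (torus means) x → ∫ ∏ᵢ (plane qᵢ xᵢ − ∫ plane qᵢ xᵢ dμ) dμ`. [folklore] -/
theorem tendsto_torusMomentStr_infVolWeight (r : LatticeRep G) {β : ℝ} {S : ℕ → ℕ} {μ : Measure (LGConfig 4 G)}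
    (hlim : IsInfiniteVolumeLimitAlong (d := 4) r.ρ β (fun k => 2 * S k) μ) {n : ℕ} (q : Fin n → Fin 4 × Fin 4)
    (x : Fin n → Site 4) :
    Tendsto (fun k => torusMomentStr r.ρ β (S k) (fun i U => plaquetteObs r.ρ 0 (q i).1 (q i).2 U)
        (fun i => wilsonTorusMean r.ρ β (S k) (fun U => plaquetteObs r.ρ 0 (q i).1 (q i).2 U)) x) atTop
      (𝓝 (∫ U, ∏ i, (plane G r (q i) (x i) U - ∫ V, plane G r (q i) (x i) V ∂μ) ∂μ)) := by
  obtain ⟨Cp, hCp⟩ := exists_abs_plane_le (G := G) r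
  have h := tendsto_wilsonExpectation_centred_prod r.ρ r.continuous hlim (fun i => plane G r (q i) (x i))
    (fun i => ⟨_, isCylinder_plane r (q i) (x i)⟩) (fun i => continuous_plane r (q i) (x i))
    (fun i => measurable_plane r (q i) (x i)) (fun i => ⟨Cp, hCp (q i) (x i)⟩)
  refine h.congr fun k => ?_
  rw [← torusE_prod_plane_eq_torusMomentStr]
  rfl

end PointwiseG

/-! ## §2 Tannery: torus box sums converge to the infinite-volume series at fixed spacing -/

section Tannery

variable {G : Type} [Group G] [TopologicalSpace G] [IsTopologicalGroup G] [CompactSpace G]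
  [MeasurableSpace G] [BorelSpace G]

/-- **TORUS → INFINITE VOLUME AT FIXED SPACING (Tannery).**  Along `IsInfiniteVolumeLimitAlong r.ρ β (2S·) μ` with `S`
strictly increasing, for `0 < a ≤ 1`, evaluation points `‖(y x)_l − a·x_l‖ ≤ s·a` with `s·a ≤ 1/4`, every string `q`
and EVERY Schwartz `F`:
`Σ_{x ∈ (box (S k))ⁿ} torusMomentStr_k(x)·F(y x) → Σ'ₓ (∫ ∏ᵢ (plane qᵢ xᵢ − ∫ plane qᵢ xᵢ dμ) dμ)·F(y x)`
(pointwise convergence of the weights, §1; domination by `(Cₚ+Cₚ)ⁿ·‖F(y x)‖`, summable by step 3). [folklore] -/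
theorem tendsto_sum_torusMomentStr_mul_tsum (r : LatticeRep G) {β : ℝ} {S : ℕ → ℕ} (hS : StrictMono S)
    {μ : Measure (LGConfig 4 G)} (hlim : IsInfiniteVolumeLimitAlong (d := 4) r.ρ β (fun k => 2 * S k) μ)
    {a s : ℝ} (ha : 0 < a) (ha1 : a ≤ 1) (hsa : s * a ≤ 1 / 4) {n : ℕ} (q : Fin n → Fin 4 × Fin 4)
    (F : 𝓢((Fin n → EuclideanSpace ℝ (Fin 4)), ℂ)) (y : (Fin n → Site 4) → (Fin n → EuclideanSpace ℝ (Fin 4)))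
    (hyx : ∀ x l, ‖y x l - a • siteToE (x l)‖ ≤ s * a) :
    Tendsto (fun k => ∑ x ∈ Fintype.piFinset (fun _ : Fin n => box 4 (S k)),
        ((torusMomentStr r.ρ β (S k) (fun i U => plaquetteObs r.ρ 0 (q i).1 (q i).2 U)
          (fun i => wilsonTorusMean r.ρ β (S k) (fun U => plaquetteObs r.ρ 0 (q i).1 (q i).2 U)) x : ℝ) : ℂ) *
          F (y x)) atTop
      (𝓝 (∑' x : Fin n → Site 4,
        (((∫ U, ∏ i, (plane G r (q i) (x i) U - ∫ V, plane G r (q i) (x i) V ∂μ) ∂μ : ℝ) : ℂ)) * F (y x))) := by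
  classical
  obtain ⟨Cp, hCp⟩ := exists_abs_plane_le (G := G) r
  have hCp0 : 0 ≤ Cp := le_trans (abs_nonneg _) (hCp (0, 1) 0 (fun _ => 1))
  -- the torus weights and their zero extensions
  set tm : ℕ → (Fin n → Site 4) → ℝ := fun k x => torusMomentStr r.ρ β (S k)
    (fun i U => plaquetteObs r.ρ 0 (q i).1 (q i).2 U)
    (fun i => wilsonTorusMean r.ρ β (S k) (fun U => plaquetteObs r.ρ 0 (q i).1 (q i).2 U)) x with htm
  set f : ℕ → (Fin n → Site 4) → ℂ := fun k x =>
    if x ∈ Fintype.piFinset (fun _ : Fin n => box 4 (S k)) then ((tm k x : ℝ) : ℂ) * F (y x) else 0 with hf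
  have hsum_eq : ∀ k, ∑ x ∈ Fintype.piFinset (fun _ : Fin n => box 4 (S k)), ((tm k x : ℝ) : ℂ) * F (y x) =
      ∑' x : Fin n → Site 4, f k x := fun k => by
    rw [tsum_eq_sum (s := Fintype.piFinset (fun _ : Fin n => box 4 (S k))) (fun x hx => by
      simp only [hf, if_neg hx])]
    exact Finset.sum_congr rfl fun x hx => by simp only [hf, if_pos hx]
  -- pointwise convergence
  have hpt : ∀ x : Fin n → Site 4, Tendsto (fun k => f k x) atTop
      (𝓝 ((((∫ U, ∏ i, (plane G r (q i) (x i) U - ∫ V, plane G r (q i) (x i) V ∂μ) ∂μ : ℝ) : ℂ)) * F (y x))) := by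
    intro x
    have h1 : Tendsto (fun k => ((tm k x : ℝ) : ℂ) * F (y x)) atTop
        (𝓝 ((((∫ U, ∏ i, (plane G r (q i) (x i) U - ∫ V, plane G r (q i) (x i) V ∂μ) ∂μ : ℝ) : ℂ)) * F (y x))) :=
      ((tendsto_torusMomentStr_infVolWeight r hlim q x).ofReal).mul_const _
    refine h1.congr' ?_
    filter_upwards [eventually_mem_piFinset_box hS x] with k hk
    simp only [hf, if_pos hk]
  -- domination
  have hbound : ∀ k x, ‖f k x‖ ≤ |(Cp + Cp) ^ n| * ‖F (y x)‖ := fun k x => by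
    by_cases hx : x ∈ Fintype.piFinset (fun _ : Fin n => box 4 (S k))
    · simp only [hf, if_pos hx, norm_mul, Complex.norm_real, Real.norm_eq_abs]
      exact mul_le_mul_of_nonneg_right ((abs_torusMomentStr_plane_le r hCp β (S k) q x).trans (le_abs_self _))
        (norm_nonneg _)
    · simp only [hf, if_neg hx, norm_zero]
      positivity
  have hsumm : Summable fun x : Fin n → Site 4 => |(Cp + Cp) ^ n| * ‖F (y x)‖ :=
    summable_abs_mul_norm_of_bounded ha ha1 hsa (abs_nonneg ((Cp + Cp) ^ n)) (fun _ => (Cp + Cp) ^ n)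
      (fun _ => le_rfl) F y hyx
  have key := tendsto_tsum_of_dominated_convergence hsumm hpt (Eventually.of_forall hbound)
  exact key.congr fun k => (hsum_eq k).symm

/-- **The spine's torus distribution converges to the infinite-volume series** (base points `y x = a·x`):
`latticeDistStr r.ρ β (S k) a (planes q) (torus means) F → Σ'ₓ W_μ(q,x)·F(a·x)` for every Schwartz `F`, `0 < a ≤ 1`.
[folklore] -/
theorem tendsto_latticeDistStr_tsum (r : LatticeRep G) {β : ℝ} {S : ℕ → ℕ} (hS : StrictMono S)
    {μ : Measure (LGConfig 4 G)} (hlim : IsInfiniteVolumeLimitAlong (d := 4) r.ρ β (fun k => 2 * S k) μ)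
    {a : ℝ} (ha : 0 < a) (ha1 : a ≤ 1) {n : ℕ} (q : Fin n → Fin 4 × Fin 4)
    (F : 𝓢((Fin n → EuclideanSpace ℝ (Fin 4)), ℂ)) :
    Tendsto (fun k => latticeDistStr r.ρ β (S k) a (fun i U => plaquetteObs r.ρ 0 (q i).1 (q i).2 U)
        (fun i => wilsonTorusMean r.ρ β (S k) (fun U => plaquetteObs r.ρ 0 (q i).1 (q i).2 U)) F) atTop
      (𝓝 (∑' x : Fin n → Site 4,
        (((∫ U, ∏ i, (plane G r (q i) (x i) U - ∫ V, plane G r (q i) (x i) V ∂μ) ∂μ : ℝ) : ℂ)) *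
          F (fun l => a • siteToE (x l)))) := by
  have h := tendsto_sum_torusMomentStr_mul_tsum r hS hlim (s := 0) ha ha1 (by norm_num) q F
    (fun x l => a • siteToE (x l)) (fun x l => by simp)
  refine h.congr fun k => ?_
  rw [latticeDistStr_apply]

/-- Packaging for `μ ∈ oddTorusLimitPoints r β`: there is a strictly increasing odd-torus sequence along which the
spine's torus distributions at spacing `a` converge to the infinite-volume series of `μ`, for every string and
every Schwartz test function. [folklore] -/
theorem exists_tendsto_latticeDistStr_of_mem_oddTorusLimitPoints (r : LatticeRep G) {β : ℝ}
    {μ : Measure (LGConfig 4 G)} (hμ : μ ∈ oddTorusLimitPoints r β) {a : ℝ} (ha : 0 < a) (ha1 : a ≤ 1) :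
    ∃ S : ℕ → ℕ, StrictMono S ∧ IsInfiniteVolumeLimitAlong (d := 4) r.ρ β (fun k => 2 * S k) μ ∧
      ∀ (n : ℕ) (q : Fin n → Fin 4 × Fin 4) (F : 𝓢((Fin n → EuclideanSpace ℝ (Fin 4)), ℂ)),
        Tendsto (fun k => latticeDistStr r.ρ β (S k) a (fun i U => plaquetteObs r.ρ 0 (q i).1 (q i).2 U)
            (fun i => wilsonTorusMean r.ρ β (S k) (fun U => plaquetteObs r.ρ 0 (q i).1 (q i).2 U)) F) atTop
          (𝓝 (∑' x : Fin n → Site 4,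
            (((∫ U, ∏ i, (plane G r (q i) (x i) U - ∫ V, plane G r (q i) (x i) V ∂μ) ∂μ : ℝ) : ℂ)) *
              F (fun l => a • siteToE (x l)))) := by
  obtain ⟨S, hS, hlim⟩ := hμ
  exact ⟨S, hS, hlim, fun n q F => tendsto_latticeDistStr_tsum r hS hlim ha ha1 q F⟩

end Tannery

/-! ## §3 Diagonal selection above a growth demand -/

section Diagonal

/-- **Diagonal selection.**  For each level `k` and each member `i` of a countable family, a sequence
`m ↦ u k i m` converging to `c k i`; `g` any growth demand.  Then there is `L : ℕ → ℕ` with `g k ≤ L k` such that for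
every `i`, eventually in `k`: `‖u k i (L k) − c k i‖ ≤ 1/(k+1)` (at level `k` the first `k+1` members of the family
are served). [folklore] -/
theorem exists_growth_diagonal {ι : Type*} [Countable ι] {E : Type*} [NormedAddCommGroup E]
    (u : ℕ → ι → ℕ → E) (c : ℕ → ι → E) (hu : ∀ k i, Tendsto (fun m => u k i m) atTop (𝓝 (c k i)))
    (g : ℕ → ℕ) :
    ∃ L : ℕ → ℕ, (∀ k, g k ≤ L k) ∧ ∀ i, ∀ᶠ k in atTop, ‖u k i (L k) - c k i‖ ≤ 1 / ((k : ℝ) + 1) := by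
  classical
  -- an encoding of the family
  obtain ⟨enc, henc⟩ : ∃ enc : ι → ℕ, Function.Injective enc := by
    rcases isEmpty_or_nonempty ι with hι | hι
    · exact ⟨fun _ => 0, fun a => (hι.false a).elim⟩
    · obtain ⟨f, hf⟩ := Countable.exists_injective_nat ι
      exact ⟨f, hf⟩
  -- thresholds `M k i`: beyond them the `k`-th sequence of `i` is `1/(k+1)`-close to its limit
  have hM : ∀ k i, ∃ M : ℕ, ∀ m, M ≤ m → ‖u k i m - c k i‖ ≤ 1 / ((k : ℝ) + 1) := fun k i => by
    have h2 := (tendsto_iff_norm_sub_tendsto_zero.1 (hu k i))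
    obtain ⟨M, hM⟩ := eventually_atTop.1 (h2.eventually (eventually_le_nhds (show (0 : ℝ) < 1 / ((k : ℝ) + 1) by
      positivity)))
    exact ⟨M, hM⟩
  choose M hM using hM
  -- at level `k` serve the members encoded below `k + 1`
  refine ⟨fun k => max (g k) ((Finset.range (k + 1)).sup fun j =>
      if h : ∃ i, enc i = j then M k h.choose else 0), fun k => le_max_left _ _, fun i => ?_⟩
  refine eventually_atTop.2 ⟨enc i, fun k hk => hM k i _ ?_⟩
  have hex : ∃ i', enc i' = enc i := ⟨i, rfl⟩
  have hchoose : hex.choose = i := henc hex.choose_spec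
  calc M k i = (if h : ∃ i', enc i' = enc i then M k h.choose else 0) := by rw [dif_pos hex, hchoose]
    _ ≤ (Finset.range (k + 1)).sup fun j => if h : ∃ i', enc i' = j then M k h.choose else 0 :=
        Finset.le_sup (f := fun j => if h : ∃ i', enc i' = j then M k h.choose else 0)
          (Finset.mem_range.2 (Nat.lt_succ_of_le hk))
    _ ≤ _ := le_max_right _ _

/-- Consequence: along the diagonal, `u k i (L k) − c k i → 0` for every member `i`. [folklore] -/
theorem tendsto_sub_diagonal {ι : Type*} {E : Type*} [NormedAddCommGroup E] {u : ℕ → ι → ℕ → E}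
    {c : ℕ → ι → E} {L : ℕ → ℕ} (hL : ∀ i, ∀ᶠ k in atTop, ‖u k i (L k) - c k i‖ ≤ 1 / ((k : ℝ) + 1)) (i : ι) :
    Tendsto (fun k => u k i (L k) - c k i) atTop (𝓝 0) := by
  refine squeeze_zero_norm' (hL i) ?_
  exact tendsto_one_div_add_atTop_nhds_zero_nat

end Diagonal

end Summit.QuantumFields.YangMills.Theorems.InfiniteVolume

end
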